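import Mathlib
import Summits.Ventures.PercRepro2.TwoHullMasterPrismSub
import Summits.Ventures.PercRepro2.TwoHullMasterBlockCheckRigid

/-!
# The RIGID (MM) on the subdivided prism — the lane's last two pairs' rigid row (blind cell
PercRepro2, night-4 g40, 2026-08-29; proofs/NIGHT4-G40.md §8′)

The graph of NIGHT4-G38 §7 (`subEdges`, the prism with a matching edge subdivided by `o = 0`),
`l = 2`, `h = 3` and `h = 4`: rigid σ-symmetric cube covers with five classes
(`subBlocksRigid3`, 14 blocks; `subBlocksRigid4`, 13 blocks; kit j333640, re-verified off-line),
accepted by the rigid checker by a kernel computation: **`twoHullMasterRigid_sub3`**,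
**`twoHullMasterRigid_sub4`** — the rigid (MM) for every pair of up-sets — and
**`swAll_sub3 o`**, **`swAll_sub4 o`**: the rigid row 2′SW-ALL for every mark, in particular the
two pairs of record (`o = 0`), now corollaries of the block principle rather than of an explicit
matching certificate.
-/

namespace Summit.Ventures.PercRepro2

namespace Prism

open Hull LocRows SwCheck BlockCheck BlockCheckRigid

/-- The rigid cube cover of `U` for `l = 2`, `h = 3` (14 blocks). -/
def subBlocksRigid3 : List (ℕ × List ℕ) :=
  [(972, [15, 432, 64, 512]), (717, [3, 4, 472, 544]), (205, [3, 4, 360, 656]),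
    (204, [327, 40, 656]), (236, [325, 698]), (197, [1, 366, 656]), (229, [3, 1020]),
    (716, [501, 522]), (452, [1023]), (708, [1021, 2]), (709, [1023]), (964, [1023]),
    (973, [3, 4, 8, 944, 64]), (461, [3, 4, 8, 944, 64])]

/-- The rigid cube cover of `U` for `l = 2`, `h = 4` (13 blocks). -/
def subBlocksRigid4 : List (ℕ × List ℕ) :=
  [(972, [15, 432, 64, 512]), (845, [3, 484, 8, 528]), (333, [3, 212, 8, 800]),
    (332, [203, 20, 800]), (348, [201, 822]), (329, [1, 222, 800]), (345, [3, 1020]),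
    (456, [893, 130]), (968, [893, 130]), (841, [1, 1022]), (844, [1023]),
    (973, [3, 4, 8, 944, 64]), (461, [3, 4, 8, 944, 64])]

/-- The rigid checker accepts the cover for `h = 3` (kernel computation). -/
theorem checkCoverRigid_sub3 : checkCoverRigid subEdges 2 3 subBlocksRigid3 = true := by
  decide +kernel

/-- The rigid checker accepts the cover for `h = 4` (kernel computation). -/
theorem checkCoverRigid_sub4 : checkCoverRigid subEdges 2 4 subBlocksRigid4 = true := by
  decide +kernel

/-- **The rigid (MM) on the subdivided prism, `l = 2`, `h = 3`.** -/
theorem twoHullMasterRigid_sub3 : TwoHullMasterRigid (endsOf subEdges) 2 3 :=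
  twoHullMasterRigid_of_checkCoverRigid subEdges 2 3 subBlocksRigid3 checkCoverRigid_sub3

/-- **The rigid (MM) on the subdivided prism, `l = 2`, `h = 4`.** -/
theorem twoHullMasterRigid_sub4 : TwoHullMasterRigid (endsOf subEdges) 2 4 :=
  twoHullMasterRigid_of_checkCoverRigid subEdges 2 4 subBlocksRigid4 checkCoverRigid_sub4

/-- The rigid row 2′SW-ALL for `l = 2`, `h = 3` and every mark — the first pair of record is `o = 0`. -/
theorem swAll_sub3 (o : Fin 7) : SwAll (endsOf subEdges) 2 3 o :=
  swAll_of_twoHullMasterRigid o twoHullMasterRigid_sub3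

/-- The rigid row 2′SW-ALL for `l = 2`, `h = 4` and every mark — the second pair of record is `o = 0`. -/
theorem swAll_sub4 (o : Fin 7) : SwAll (endsOf subEdges) 2 4 o :=
  swAll_of_twoHullMasterRigid o twoHullMasterRigid_sub4

end Prism

end Summit.Ventures.PercRepro2
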